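import Mathlib
import Summits.NavierStokesRegularity.NavierStokesRegularity.Theorems.FilamentSkeletonRssDefectColumnGateColumnVorticity

/-!
# Route `FilamentSkeletonRss` · crux `TransverseReduction1AG` (stmt-NavierStokesRegularity-27853) · line `defect_column_gate_1AG` —
# THE S2a OPERATOR ON HORIZONTAL, AXIALLY CONSTANT PERTURBATIONS (stream-function form): reduction to ONE SCALAR 2D OPERATOR

Helper file (theorems only, `--supports stmt-NavierStokesRegularity-27853 --as helper`; LEAD of 27853, lane ns-filament-21221-p1 g10).  This is the
kernel-checked part of §2 of the lead's memo `S2A-FALSE-FARFIELD-27853-g10.md` (evidence #25 on stmt-27853: the registered stub S2a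
`WaistColumnGate1A` is false as typed) and the first helper named in the brief of its replacement S2a-loc `WaistColumnGateLoc1A`.
HONEST FRAMING: calculus identities about the MODEL operator of a HYPOTHETICAL filament-type rotating-self-similar blow-up route (MODEL rung, negative
side); no stub is proved or refuted IN LEAN here; nothing here bears on Navier–Stokes regularity; `TransverseReduction1AG` is neither proved nor refuted.

Setting: axis `d = e₃`, a `C⁴` stream function `Ψ` constant along the axis (`DΨ(y)[e₃] = 0`), `W := ∇Ψ × e₃` (horizontal, solenoidal, axially
constant), `w := −ΔΨ` (so `curl W = w·e₃`), `S = colSwirl gam Rc e₃`, `ζ = (gam Rc/4π)e^{−gam(|y|²−y₃²)/4}`, `Ω_bg = curlCLM B + 2α e₃`, `B e₃ = κ e₃`.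
* `laplacian_smul_const`, `contDiff_two_laplacian`, `fderiv_gradient_axis` (`D(∇Ψ)(y)[e₃] = 0`), `contDiff_streamField`, `hasFDerivAt_streamField`,
  `fderiv_streamField_axis`, `isDivFree_streamField`, **`curl_streamField`** (`curl W = (−ΔΨ)·e₃`), `fderiv_colSwirl_axis` (`DS(y)[e₃] = 0`);
* **`colForceVort_streamField`** — for solenoidal `U⁰_col` (tree `isDivFree_colBase`):
  `colForceVort B α gam Rc e₃ W = ((3/2 − κ)·w + Dw[By] − Δw + Dw[S] − (gam/2)ζ⟨y − y₃e₃, W⟩)·e₃ − DW[Ω_bg]`,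
  i.e. on these perturbations the S2a operator IS the classical scalar linearisation `−Δw − gam·w + (By)·∇w + S·∇w + W·∇ζ` at a Gaussian column in the
  plane strain `B|_{e₃^⊥}` (times `e₃`), up to the tilting of the uniform background vorticity `Ω_bg` — the operator whose far field carries the
  quasimodes of the memo as soon as the strain asymmetry exceeds `gam/4`.
-/

set_option linter.dupNamespace false

noncomputable section

namespace Summit.NavierStokesRegularity.NavierStokesRegularity.Theorems.DefectColumnGate

open scoped BigOperators Topology InnerProductSpace Laplacian ContDiff
open Set Function
open Literature.Analysis.FluidPDE
open Summit.NavierStokesRegularity.NavierStokesRegularity.Theorems.KelvinGate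

/-! ## 1. Scalar calculus helpers -/

/-- `Δ(w·v) = (Δw)·v` for a `C²` scalar `w` and a constant vector `v`. -/
theorem laplacian_smul_const {w : EuclideanSpace ℝ (Fin 3) → ℝ} (hw : ContDiff ℝ 2 w) (v : EuclideanSpace ℝ (Fin 3))
    (y : EuclideanSpace ℝ (Fin 3)) :
    (Δ (fun z => w z • v)) y = (Δ w) y • v := by
  have e : (fun z => w z • v) = ((ContinuousLinearMap.id ℝ ℝ).smulRight v) ∘ w := by
    funext z; simp
  rw [e, hw.contDiffAt.laplacian_CLM_comp_left]
  simp

/-- The Laplacian of a `C⁴` scalar on `ℝ³` is `C²`. -/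
theorem contDiff_two_laplacian {Ψ : EuclideanSpace ℝ (Fin 3) → ℝ} (hΨ : ContDiff ℝ 4 Ψ) : ContDiff ℝ 2 (Δ Ψ) := by
  rw [KelvinGate.laplacian_eq_sum_fderiv_fderiv]
  have hQc : ContDiff ℝ 2 (fderiv ℝ (fderiv ℝ Ψ)) :=
    (hΨ.fderiv_right (m := 3) (by norm_num)).fderiv_right (m := 2) (by norm_num)
  exact ContDiff.sum fun i _ => (hQc.clm_apply contDiff_const).clm_apply contDiff_const

/-- The gradient of a `C^{n+1}` scalar is `C^n` (`∇Ψ = toDual⁻¹ ∘ DΨ`). -/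
theorem contDiff_gradient {Ψ : EuclideanSpace ℝ (Fin 3) → ℝ} {n : ℕ∞} (hΨ : ContDiff ℝ (n + 1) Ψ) : ContDiff ℝ n (gradient Ψ) := by
  have e : gradient Ψ = (InnerProductSpace.toDual ℝ (EuclideanSpace ℝ (Fin 3))).symm ∘ (fderiv ℝ Ψ) := rfl
  rw [e]
  exact (InnerProductSpace.toDual ℝ (EuclideanSpace ℝ (Fin 3))).symm.contDiff.comp (hΨ.fderiv_right (m := n) le_rfl)

/-- **Axial constancy passes to the gradient**: if `DΨ(y)[e₃] = 0` for all `y` (and `Ψ ∈ C²`) then `D(∇Ψ)(y)[e₃] = 0`. -/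
theorem fderiv_gradient_axis {Ψ : EuclideanSpace ℝ (Fin 3) → ℝ} (hΨ : ContDiff ℝ 2 Ψ)
    (hax : ∀ y, fderiv ℝ Ψ y (EuclideanSpace.single 2 1) = 0) (y : EuclideanSpace ℝ (Fin 3)) :
    fderiv ℝ (gradient Ψ) y (EuclideanSpace.single 2 1) = 0 := by
  refine ext_inner_right ℝ fun k => ?_
  rw [inner_zero_left, inner_fderiv_gradient_comm hΨ y (EuclideanSpace.single 2 1) k]
  -- `⟪D(∇Ψ)(y) k, e₃⟫ = D²Ψ(y)[k][e₃] = D(z ↦ DΨ(z)[e₃])(y)[k] = 0`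
  have e : gradient Ψ = (InnerProductSpace.toDual ℝ (EuclideanSpace ℝ (Fin 3))).symm ∘ (fderiv ℝ Ψ) := rfl
  have hDg : fderiv ℝ (gradient Ψ) y k =
      (InnerProductSpace.toDual ℝ (EuclideanSpace ℝ (Fin 3))).symm (fderiv ℝ (fderiv ℝ Ψ) y k) := by
    rw [e, LinearIsometryEquiv.comp_fderiv]; rfl
  rw [hDg, InnerProductSpace.toDual_symm_apply]
  have hPd : HasFDerivAt (fderiv ℝ Ψ) (fderiv ℝ (fderiv ℝ Ψ) y) y :=
    (((hΨ.fderiv_right (m := 1) (by norm_num)).differentiable (by norm_num)) y).hasFDerivAt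
  have h3 : HasFDerivAt (fun z => fderiv ℝ Ψ z (EuclideanSpace.single 2 1))
      ((fderiv ℝ (fderiv ℝ Ψ) y).flip (EuclideanSpace.single 2 1)) y := KelvinGate.hasFDerivAt_clm_apply_const hPd _
  have h0 : (fun z => fderiv ℝ Ψ z (EuclideanSpace.single 2 1)) = fun _ => (0:ℝ) := funext hax
  rw [h0] at h3
  have h4 : (fderiv ℝ (fderiv ℝ Ψ) y).flip (EuclideanSpace.single 2 1) = 0 := h3.unique (hasFDerivAt_const (0:ℝ) y)
  have h5 := congrArg (fun L : EuclideanSpace ℝ (Fin 3) →L[ℝ] ℝ => L k) h4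
  simpa only [ContinuousLinearMap.flip_apply, _root_.zero_apply] using h5

/-! ## 2. The horizontal, axially constant perturbation `W = ∇Ψ × e₃` -/

/-- `W = ∇Ψ × e₃` is `C³` for `Ψ ∈ C⁴`. -/
theorem contDiff_streamField {Ψ : EuclideanSpace ℝ (Fin 3) → ℝ} (hΨ : ContDiff ℝ 4 Ψ) :
    ContDiff ℝ 3 (fun y => cross (gradient Ψ y) (EuclideanSpace.single 2 1)) := by
  have e : (fun y => cross (gradient Ψ y) (EuclideanSpace.single 2 1)) =
      fun y => (crossCLM.flip (EuclideanSpace.single (2 : Fin 3) (1:ℝ))) (gradient Ψ y) := by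
    funext y; simp [ContinuousLinearMap.flip_apply, crossCLM_apply]
  rw [e]
  exact (crossCLM.flip _).contDiff.comp (contDiff_gradient (n := 3) hΨ)

/-- Derivative of `W = ∇Ψ × e₃`: `DW(y) h = (D(∇Ψ)(y) h) × e₃`. -/
theorem hasFDerivAt_streamField {Ψ : EuclideanSpace ℝ (Fin 3) → ℝ} (hΨ : ContDiff ℝ 2 Ψ) (y : EuclideanSpace ℝ (Fin 3)) :
    HasFDerivAt (fun y => cross (gradient Ψ y) (EuclideanSpace.single 2 1))
      ((crossCLM.flip (EuclideanSpace.single (2 : Fin 3) (1:ℝ))).comp (fderiv ℝ (gradient Ψ) y)) y := by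
  have hd : DifferentiableAt ℝ (gradient Ψ) y := (contDiff_gradient (n := 1) hΨ).differentiable (by norm_num) y
  have h := (crossCLM.flip (EuclideanSpace.single (2 : Fin 3) (1:ℝ))).hasFDerivAt.comp y hd.hasFDerivAt
  have e : (⇑(crossCLM.flip (EuclideanSpace.single (2 : Fin 3) (1:ℝ))) ∘ gradient Ψ) =
      fun y => cross (gradient Ψ y) (EuclideanSpace.single 2 1) := by
    funext z; simp [ContinuousLinearMap.flip_apply, crossCLM_apply]
  rw [e] at h
  exact h

/-- `W = ∇Ψ × e₃` does not vary along the axis when `Ψ` does not: `DW(y)[e₃] = 0`. -/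
theorem fderiv_streamField_axis {Ψ : EuclideanSpace ℝ (Fin 3) → ℝ} (hΨ : ContDiff ℝ 2 Ψ)
    (hax : ∀ y, fderiv ℝ Ψ y (EuclideanSpace.single 2 1) = 0) (y : EuclideanSpace ℝ (Fin 3)) :
    fderiv ℝ (fun y => cross (gradient Ψ y) (EuclideanSpace.single 2 1)) y (EuclideanSpace.single 2 1) = 0 := by
  rw [(hasFDerivAt_streamField hΨ y).fderiv, ContinuousLinearMap.comp_apply, fderiv_gradient_axis hΨ hax y, map_zero]

/-- `W = ∇Ψ × e₃` is divergence free (`div(∇Ψ × e₃) = ⟨e₃, curl ∇Ψ⟩ − ⟨∇Ψ, curl e₃⟩ = 0`). -/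
theorem isDivFree_streamField {Ψ : EuclideanSpace ℝ (Fin 3) → ℝ} (hΨ : ContDiff ℝ 2 Ψ) :
    VectorCalculus.IsDivFree (fun y => cross (gradient Ψ y) (EuclideanSpace.single 2 1)) := by
  intro y
  have hd : DifferentiableAt ℝ (gradient Ψ) y := (contDiff_gradient (n := 1) hΨ).differentiable (by norm_num) y
  rw [divergence_cross_holds (gradient Ψ) (fun _ => EuclideanSpace.single 2 1) y hd (differentiableAt_const _),
    curl_gradient_eq_zero_holds Ψ hΨ y, inner_zero_right, zero_sub, neg_eq_zero,
    curl_eq_zero_of_fderiv_eq_zero (by simp), inner_zero_right]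

/-- **`curl (∇Ψ × e₃) = (−ΔΨ)·e₃`** for an axially constant `C²` stream function. -/
theorem curl_streamField {Ψ : EuclideanSpace ℝ (Fin 3) → ℝ} (hΨ : ContDiff ℝ 2 Ψ)
    (hax : ∀ y, fderiv ℝ Ψ y (EuclideanSpace.single 2 1) = 0) (y : EuclideanSpace ℝ (Fin 3)) :
    curl (fun y => cross (gradient Ψ y) (EuclideanSpace.single 2 1)) y = (-(Δ Ψ) y) • EuclideanSpace.single 2 1 := by
  rw [curl_cross_gradient_const hΨ y, fderiv_gradient_axis hΨ hax y, zero_sub, neg_smul]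

/-- `curl_streamField` as an equality of fields. -/
theorem curl_streamField_eq {Ψ : EuclideanSpace ℝ (Fin 3) → ℝ} (hΨ : ContDiff ℝ 2 Ψ)
    (hax : ∀ y, fderiv ℝ Ψ y (EuclideanSpace.single 2 1) = 0) :
    curl (fun y => cross (gradient Ψ y) (EuclideanSpace.single 2 1)) = fun y => (-(Δ Ψ) y) • EuclideanSpace.single 2 1 :=
  funext fun y => curl_streamField hΨ hax y

/-- The column swirl about `e₃` does not vary along `e₃`: `DS(y)[e₃] = 0`. -/
theorem fderiv_colSwirl_axis (gam Rc : ℝ) (y : EuclideanSpace ℝ (Fin 3)) :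
    fderiv ℝ (colSwirl gam Rc (EuclideanSpace.single 2 1)) y (EuclideanSpace.single 2 1) = 0 := by
  have hd : ‖(EuclideanSpace.single (2 : Fin 3) (1:ℝ))‖ = 1 := by
    rw [EuclideanSpace.norm_eq]; simp
  rw [(hasFDerivAt_colSwirl gam Rc (EuclideanSpace.single 2 1) y).fderiv]
  simp only [_root_.add_apply, _root_.smul_apply, crossCLM_apply, ContinuousLinearMap.smulRight_apply, innerSL_apply_apply,
    real_inner_smul_left]
  rw [inner_sub_proj_axis hd, mul_zero, zero_smul, add_zero]
  have hcross : cross (EuclideanSpace.single (2 : Fin 3) (1:ℝ)) (EuclideanSpace.single 2 1) = 0 := by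
    ext i; fin_cases i <;> simp [cross]
  rw [hcross, smul_zero]

/-! ## 3. The S2a operator on `W = ∇Ψ × e₃` -/

/-- **THE S2a OPERATOR ON HORIZONTAL, AXIALLY CONSTANT PERTURBATIONS.**  Let `Ψ ∈ C⁴` be constant along `e₃`, `W := ∇Ψ × e₃`, and let the frozen
waist model base `U⁰_col = colBase B α gam Rc e₃` be solenoidal with `B e₃ = κ e₃`.  Then, with `S = colSwirl gam Rc e₃` and the uniform background
vorticity `Ω_bg = curlCLM B + 2α e₃`,
`colForceVort B α gam Rc e₃ W (y) = ( (3/2 − κ)·w(y) + Dw(y)[By] − Δw(y) + Dw(y)[S y] − (gam/2)·(gam Rc/4π)e^{−gam(|y|²−y₃²)/4}·⟨y − y₃e₃, W y⟩ )·e₃ − DW(y)[Ω_bg]`,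
`w := −ΔΨ`: one SCALAR second-order operator (`−Δ − gam + (By)·∇ + S·∇` plus the radial-Gaussian multiplication term from `W·∇ζ`) times `e₃`, plus the
tilting of `Ω_bg`.  (From `colForceVort_eq_of_norm`: `DS[ω′] = w·DS[e₃] = 0`, `DW[Ω_S] = ζ·DW[e₃] = 0`, `Bω′ = κ·w·e₃`.) -/
theorem colForceVort_streamField {B : EuclideanSpace ℝ (Fin 3) →L[ℝ] EuclideanSpace ℝ (Fin 3)} {α gam Rc κ : ℝ}
    (hBd : B (EuclideanSpace.single 2 1) = κ • EuclideanSpace.single 2 1)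
    (hdivU : VectorCalculus.IsDivFree (colBase B α gam Rc (EuclideanSpace.single 2 1)))
    {Ψ : EuclideanSpace ℝ (Fin 3) → ℝ} (hΨ : ContDiff ℝ 4 Ψ) (hax : ∀ y, fderiv ℝ Ψ y (EuclideanSpace.single 2 1) = 0)
    (y : EuclideanSpace ℝ (Fin 3)) :
    colForceVort B α gam Rc (EuclideanSpace.single 2 1) (fun z => cross (gradient Ψ z) (EuclideanSpace.single 2 1)) y =
      ((3/2 - κ) * (-(Δ Ψ) y) + fderiv ℝ (fun z => -(Δ Ψ) z) y (B y) - (Δ (fun z => -(Δ Ψ) z)) y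
          + fderiv ℝ (fun z => -(Δ Ψ) z) y (colSwirl gam Rc (EuclideanSpace.single 2 1) y)
          + (-(gam * Rc / (4 * Real.pi) * Real.exp (-(gam * (‖y‖ ^ 2 - ⟪y, EuclideanSpace.single 2 1⟫_ℝ ^ 2) / 4)) * (gam / 2)) *
              ⟪y - ⟪y, EuclideanSpace.single 2 1⟫_ℝ • EuclideanSpace.single 2 1, cross (gradient Ψ y) (EuclideanSpace.single 2 1)⟫_ℝ))
        • EuclideanSpace.single 2 1
      - fderiv ℝ (fun z => cross (gradient Ψ z) (EuclideanSpace.single 2 1)) y (curlCLM B + (2 * α) • EuclideanSpace.single 2 1) := by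
  have hd : ‖(EuclideanSpace.single (2 : Fin 3) (1:ℝ))‖ = 1 := by
    rw [EuclideanSpace.norm_eq]; simp
  have hΨ2 : ContDiff ℝ 2 Ψ := hΨ.of_le (by norm_num)
  have hW : ContDiff ℝ 3 (fun z => cross (gradient Ψ z) (EuclideanSpace.single 2 1)) := contDiff_streamField hΨ
  have hdivW := isDivFree_streamField hΨ2
  -- the scalar vorticity `w = −ΔΨ` and its regularity
  have hw : ContDiff ℝ 2 (fun z => -(Δ Ψ) z) := (contDiff_two_laplacian hΨ).neg
  have hw1 : DifferentiableAt ℝ (fun z => -(Δ Ψ) z) y := (hw.differentiable (by norm_num)) y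
  -- `curl W = w·e₃` as fields, hence its derivative and Laplacian
  have hcurl := curl_streamField_eq hΨ2 hax
  have hDcurl : fderiv ℝ (curl fun z => cross (gradient Ψ z) (EuclideanSpace.single 2 1)) y =
      (fderiv ℝ (fun z => -(Δ Ψ) z) y).smulRight (EuclideanSpace.single 2 1) := by
    rw [hcurl]; exact (hw1.hasFDerivAt.smul_const _).fderiv
  have hΔcurl : (Δ (curl fun z => cross (gradient Ψ z) (EuclideanSpace.single 2 1))) y =
      (Δ (fun z => -(Δ Ψ) z)) y • EuclideanSpace.single 2 1 := by
    rw [hcurl]; exact laplacian_smul_const hw _ y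
  rw [colForceVort_eq_of_norm hd hdivU hW hdivW y, hDcurl, hΔcurl, curl_streamField hΨ2 hax y,
    fderiv_streamField_axis hΨ2 hax y, map_smul, hBd, map_smul, fderiv_colSwirl_axis]
  simp only [ContinuousLinearMap.smulRight_apply, smul_zero, sub_zero, smul_smul]
  module

end Summit.NavierStokesRegularity.NavierStokesRegularity.Theorems.DefectColumnGate

end
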